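import Literature.NumberTheory.Automorphic.PairLFunctionMeromorphicContinuation
import Literature.NumberTheory.Automorphic.RankinSelbergIntegralHolomorphy
import HarnessLib

/-!
# The mirabolic Eisenstein series times `s (s - 1)` is entire (at each `g`)

Topic `NumberTheory/Automorphic`; namespace `Literature.NumberTheory.Automorphic`. Proof file
(theorems only: no definition, no named fact, no instance), a brick towards the named fact
`MoeglinWaldspurger1989_partialPairL_of_eq_conj` of `PairLFunctionMeromorphicContinuation`
(Mœglin–Waldspurger (1989), Appendice, Corollaire (ii): `s (s - 1) L^S(s, π ⊗ π̃)` is entire) along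
the Rankin–Selberg road of Jacquet–Shalika (1981), §4 and Cogdell (2004), §2.3, Thm. 2.1–2.2, whose
first analytic input is the continuation of the mirabolic Eisenstein series
`E(g, Φ; s) = |det g|^s ∑_{ξ ∈ ℙ^{n-1}(K)} ∫_{𝔸_Kˣ} Φ(a ξ g) |a|^{ns} dν(a)` (`mirabolicEisenstein`,
`MirabolicEisensteinSeries`) to the whole `s`-plane: "by the Poisson summation formula … `E(g, Φ; s)`
… has a meromorphic continuation with at most simple poles at `s = -iσ, 1 - iσ`" (Cogdell (2004),
§2.3, p. 211, here `η = 1`, `σ = 0`; Jacquet–Shalika (1981), §4, Lemma 4.2; Tate's Main Theorem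
4.4.1 for `n = 1`).

In the tree, Tate's decomposition of `E(1, Ψ; s)` on `Re s > 1` is proved
(`mirabolicEisenstein_one_eq_decomposition`, `MirabolicEisensteinResidue`):
`E(1, Ψ; s) = T₁(s) + c_D T₂(s) + c_D V Ψ̂(0) / (n (s - 1)) - V Ψ(0) / (n s)` with
`T₁(s) = ∫_{𝓕 ∩ {|a| ≥ 1}} Θ*_Ψ(a) |a|^{ns} dν`, `T₂(s) = ∫_{𝓕⁻¹ ∩ {|a| ≥ 1}} Θ*_{Ψ̂}(a) |a|^{n(1-s)} dν`,
and both `T₁`, `T₂` are entire (`differentiable_setIntegral_thetaStar_mul_cpow`, `…_one_sub`,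
`RankinSelbergIntegralHolomorphy`, which records only the consequence "holomorphic on `Re s > 1`").
This file records the whole-plane consequence, at each fixed `g`:

* `exists_entire_eq_mul_mirabolicEisenstein_one` — there is an entire `F` with
  `F(s) = s (s - 1) E(1, Ψ; s)` for `Re s > 1`, namely
  `F(s) = s (s - 1) (T₁(s) + c_D T₂(s)) + c_D V Ψ̂(0) s / n - V Ψ(0) (s - 1) / n`;
* `exists_entire_eq_mul_mirabolicEisenstein` — the same for `E(g, Φ; s)` at every `g`
  (`E(g, Φ; s) = |det g|^s E(1, Φ(· g); s)`), and `exists_entire_eq_mul_mirabolicEisensteinQuot` for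
  the descended series on the automorphic quotient `GL_n(𝔸_K) ⧸ A_G GL_n(K)`: the Eisenstein series
  has a meromorphic continuation to `ℂ` with at most simple poles at `s = 0, 1`.

Not here (the next bricks of Corollaire (ii)): bounds for the continued series uniform in `g` on
Siegel sets (moderate growth for all `s`), hence the entire continuation of
`s (s - 1) I(s; φ, φ', Φ)`; the functional equation `E(g, Φ; s) = E(ᵗg⁻¹, Φ̂; 1 - s)`.

## References

* J. W. Cogdell, *Analytic theory of `L`-functions for `GL_n`*, in: An Introduction to the
  Langlands Program (Birkhäuser, 2004), §2.3, p. 211, Thm. 2.1. [CogdellAnalyticTheory2004]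
* H. Jacquet, J. A. Shalika, *On Euler products and the classification of automorphic
  representations I*, Amer. J. Math. 103 (1981), §4. [JacquetShalikaAJM1981]
* J. Tate, *Fourier analysis in number fields and Hecke's zeta-functions*, in Cassels–Fröhlich,
  *Algebraic Number Theory* (1967), Ch. XV, Thm. 4.4.1. [CasselsFrohlichANT1967]
* C. Mœglin, J.-L. Waldspurger, *Le spectre résiduel de `GL(n)`*, Ann. Sci. ÉNS (4) 22 (1989),
  Appendice, Corollaire (ii), p. 667. [MoeglinWaldspurger1989]
-/

noncomputable section

open scoped NNReal ENNReal Topology MatrixGroups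
open NumberField IsDedekindDomain MeasureTheory Measure Matrix Filter Set

namespace Literature.NumberTheory.Automorphic

variable {K : Type} [Field K] [NumberField K] {n : ℕ}
variable [MeasurableSpace (AdeleRing (𝓞 K) K)] [BorelSpace (AdeleRing (𝓞 K) K)]
variable (ν : Measure (GaloisRepresentations.ideleGroup K)) [ν.IsHaarMeasure]

/-- **`s (s - 1) E(1, Ψ; s)` extends to an entire function** (`Ψ ∈ 𝒮(𝔸_Kⁿ)`, `n ≥ 1`): with Tate's
decomposition `E(1, Ψ; s) = T₁(s) + c_D T₂(s) + c_D V Ψ̂(0) / (n (s - 1)) - V Ψ(0) / (n s)` on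
`Re s > 1` (`mirabolicEisenstein_one_eq_decomposition`) and the entire parts `T₁`, `T₂`
(`differentiable_setIntegral_thetaStar_mul_cpow`, `…_one_sub`), the entire function
`F(s) = s (s - 1) (T₁(s) + c_D T₂(s)) + c_D V Ψ̂(0) s / n - V Ψ(0) (s - 1) / n` agrees with
`s (s - 1) E(1, Ψ; s)` for `Re s > 1`: the series has a meromorphic continuation to `ℂ` with at most
simple poles at `s = 0` and `s = 1` (Cogdell (2004), §2.3, p. 211; Tate, Thm. 4.4.1).
[cite: CogdellAnalyticTheory2004, §2.3, p. 211] -/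
theorem exists_entire_eq_mul_mirabolicEisenstein_one (hn : 0 < n)
    {Ψ : (Fin n → AdeleRing (𝓞 K) K) → ℂ} (hΨ : Ψ ∈ piSchwartzBruhat K (Fin n)) :
    ∃ F : ℂ → ℂ, Differentiable ℂ F ∧
      ∀ s : ℂ, 1 < s.re → F s = s * (s - 1) * mirabolicEisenstein K ν Ψ s 1 := by
  haveI := borelSpace_ideleGroup K
  haveI := secondCountableTopology_adeleRing K
  haveI := locallyCompactSpace_adeleRing' K
  obtain ⟨𝓕, h𝓕⟩ := exists_isIdeleClassDomain K
  set μ : Measure (Fin n → AdeleRing (𝓞 K) K) := Measure.addHaar with hμ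
  have hΨ' : adelicPiFourier K (Fin n) μ Ψ ∈ piSchwartzBruhat K (Fin n) :=
    adelicPiFourier_mem_piSchwartzBruhat hΨ
  have hn' : (n : ℂ) ≠ 0 := Nat.cast_ne_zero.2 hn.ne'
  have hT₁ := differentiable_setIntegral_thetaStar_mul_cpow ν h𝓕 hΨ
  have hT₂ := differentiable_setIntegral_thetaStar_mul_cpow_one_sub ν h𝓕.inv hΨ'
  refine ⟨fun s : ℂ => s * (s - 1) *
      ((∫ a in 𝓕 ∩ {a | 1 ≤ (IdeleClassGroup.ideleNorm K a : ℝ)},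
          thetaStar K Ψ a * ((IdeleClassGroup.ideleNorm K a : ℝ) : ℂ) ^ ((n : ℂ) * s) ∂ν) +
        (((μ (piFundamentalDomain K (Fin n))).toReal⁻¹ : ℝ) : ℂ) *
          (∫ a in 𝓕⁻¹ ∩ {a | 1 ≤ (IdeleClassGroup.ideleNorm K a : ℝ)},
            thetaStar K (adelicPiFourier K (Fin n) μ Ψ) a *
              ((IdeleClassGroup.ideleNorm K a : ℝ) : ℂ) ^ ((n : ℂ) * (1 - s)) ∂ν)) +
      (((μ (piFundamentalDomain K (Fin n))).toReal⁻¹ : ℝ) : ℂ) * ((idelicCovolume K ν).toReal : ℂ) *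
          adelicPiFourier K (Fin n) μ Ψ 0 * s / n -
        ((idelicCovolume K ν).toReal : ℂ) * Ψ 0 * (s - 1) / n, ?_, fun s hs => ?_⟩
  · exact (((differentiable_id.mul (differentiable_id.sub_const 1)).mul
      (hT₁.add (hT₂.const_mul _))).add
      (((differentiable_const _).mul differentiable_id).div_const _)).sub
      (((differentiable_const _).mul (differentiable_id.sub_const 1)).div_const _)
  · have hs1 : s - 1 ≠ 0 := sub_ne_zero.2 fun h => by
      rw [h, Complex.one_re] at hs
      exact lt_irrefl _ hs
    have hs0 : s ≠ 0 := fun h => by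
      rw [h, Complex.zero_re] at hs
      linarith
    rw [mirabolicEisenstein_one_eq_decomposition ν hn μ h𝓕 hΨ hs]
    field_simp

/-- **`s (s - 1) E(g, Φ; s)` extends to an entire function, for every `g ∈ GL_n(𝔸_K)`**
(`Φ ∈ 𝒮(𝔸_Kⁿ)`, `n ≥ 1`): `E(g, Φ; s) = |det g|^s E(1, Φ(· g); s)`
(`mirabolicEisenstein_eq_cpow_mul_mirabolicEisenstein_one`) with `Φ(· g) ∈ 𝒮(𝔸_Kⁿ)`
(`comp_vecMul_mem_piSchwartzBruhat`), and `s ↦ |det g|^s` is entire. "`E(g, Φ; s)` … has a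
meromorphic continuation with at most simple poles at `s = -iσ, 1 - iσ`" (`σ = 0`).
[cite: CogdellAnalyticTheory2004, §2.3, p. 211] -/
theorem exists_entire_eq_mul_mirabolicEisenstein (hn : 0 < n)
    {Φ : (Fin n → AdeleRing (𝓞 K) K) → ℂ} (hΦ : Φ ∈ piSchwartzBruhat K (Fin n))
    (g : GL (Fin n) (AdeleRing (𝓞 K) K)) :
    ∃ F : ℂ → ℂ, Differentiable ℂ F ∧
      ∀ s : ℂ, 1 < s.re → F s = s * (s - 1) * mirabolicEisenstein K ν Φ s g := by
  obtain ⟨F₁, hF₁, hF₁E⟩ :=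
    exists_entire_eq_mul_mirabolicEisenstein_one ν hn (comp_vecMul_mem_piSchwartzBruhat hΦ g)
  set d : ℂ := ((IdeleClassGroup.ideleNorm K (Matrix.GeneralLinearGroup.det g) : ℝ) : ℂ) with hd
  have hd0 : d ≠ 0 := by
    rw [hd]; exact_mod_cast (ideleNorm_real_pos (Matrix.GeneralLinearGroup.det g)).ne'
  refine ⟨fun s => d ^ s * F₁ s,
    fun s => (differentiableAt_id.const_cpow (Or.inl hd0)).mul (hF₁ s), fun s hs => ?_⟩
  change d ^ s * F₁ s = _
  rw [mirabolicEisenstein_eq_cpow_mul_mirabolicEisenstein_one ν Φ s g, hF₁E s hs]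
  ring

/-- **The descended Eisenstein series on `GL_n(𝔸_K) ⧸ A_G GL_n(K)` times `s (s - 1)` extends to an
entire function of `s`** at every point `x` (`E_X(π(g), Φ; s) = E(g⁻¹, Φ; s)`).
[cite: CogdellAnalyticTheory2004, §2.3, p. 211] -/
theorem exists_entire_eq_mul_mirabolicEisensteinQuot [ν.IsMulRightInvariant] (hn : 0 < n)
    {Φ : (Fin n → AdeleRing (𝓞 K) K) → ℂ} (hΦ : Φ ∈ piSchwartzBruhat K (Fin n))
    (x : (AdelicGroupData.gl n K).automorphicQuotient) :
    ∃ F : ℂ → ℂ, Differentiable ℂ F ∧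
      ∀ s : ℂ, 1 < s.re → F s = s * (s - 1) * mirabolicEisensteinQuot ν Φ s x := by
  obtain ⟨g, rfl⟩ := QuotientGroup.mk_surjective x
  exact exists_entire_eq_mul_mirabolicEisenstein ν hn hΦ (g⁻¹ : GL (Fin n) (AdeleRing (𝓞 K) K))

/-- **`E(g, Φ; s)` has a holomorphic continuation to `ℂ ∖ {0, 1}`** at every `g` (namely
`F(s) / (s (s - 1))` with `F` from `exists_entire_eq_mul_mirabolicEisenstein`): the poles of the
continued mirabolic Eisenstein series are confined to `s = 0, 1` and are at most simple.
[cite: CogdellAnalyticTheory2004, §2.3, p. 211] -/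
theorem exists_differentiableOn_eq_mirabolicEisenstein (hn : 0 < n)
    {Φ : (Fin n → AdeleRing (𝓞 K) K) → ℂ} (hΦ : Φ ∈ piSchwartzBruhat K (Fin n))
    (g : GL (Fin n) (AdeleRing (𝓞 K) K)) :
    ∃ E : ℂ → ℂ, DifferentiableOn ℂ E {s : ℂ | s ≠ 0 ∧ s ≠ 1} ∧
      ∀ s : ℂ, 1 < s.re → E s = mirabolicEisenstein K ν Φ s g := by
  obtain ⟨F, hF, hFE⟩ := exists_entire_eq_mul_mirabolicEisenstein ν hn hΦ g
  refine ⟨fun s => F s / (s * (s - 1)), fun s hs => ?_, fun s hs => ?_⟩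
  · have h0 : s * (s - 1) ≠ 0 := mul_ne_zero hs.1 (sub_ne_zero.mpr hs.2)
    exact ((hF s).div ((differentiableAt_id.mul (differentiableAt_id.sub_const 1))) h0)
      |>.differentiableWithinAt
  · have h0 : s ≠ 0 := fun h => by
      rw [h, Complex.zero_re] at hs
      linarith
    have h1 : s - 1 ≠ 0 := sub_ne_zero.2 fun h => by
      rw [h, Complex.one_re] at hs
      exact lt_irrefl _ hs
    change F s / (s * (s - 1)) = _
    rw [hFE s hs]
    exact mul_div_cancel_left₀ _ (mul_ne_zero h0 h1)

end Literature.NumberTheory.Automorphic
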